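import Literature.MathematicalPhysics.StatisticalMechanics.ComplexSpinChiralLRO
import Literature.Probability.LatticeModels.LatticeGreenRiemannSum
import Literature.Probability.LatticeModels.BrillouinRiemannSumUniform
import Literature.Probability.LatticeModels.TorusFourierProofs
import HarnessLib

/-!
# The fluctuation function `S(ν)`: thermodynamic limit of `S_Λ(ν)` and the bounds of
# Prop. 4.2 (Salmhofer–Seiler, CMP 139 (1991), Def. 4.1, Prop. 4.2 (1)–(2), Appendix (A.1)–(A.6),
# Remark A.5; Thm. 4.8 (4.42) and Cor. 4.9 with the printed constant)

Eleventh file of the Salmhofer–Seiler series.  `ComplexSpinChiralLRO` proves Thm. 4.8 / Cor. 4.9 in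
finite volume with the LATTICE sum `S_Λ(ν) = |Λ|⁻¹ ∑_{k ∈ Λ*∖{0}, C(k)>0} C(k)/D(k)` (`latticeS`) in
place of the printed `S(ν) = ∫_{ℬ⁺} d^νk/(2π)^ν C(k)/D(k)` (4.3).  This file supplies the passage to
the printed constant and the analytic half of Prop. 4.2, everything PROVED, no named fact:

* `fluctS ν` — **Def. 4.1 (4.3)**, `S(ν) = (2π)^{-ν} ∫_{[-π,π]^ν} (ν/D(k) - 1)⁺ d^νk`
  (`C/D · Θ(C) = (ν/D - 1)⁺` since `C = ν - D`, (4.1));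
* `momentumChar` — the dictionary between the characters `χ` of `Λ = (ℤ/Lℤ)^ν` used by the series
  (`cosSum χ = C(k)`) and the momenta `p_k = 2πk/L` of `Literature.Probability.LatticeModels`
  (`cosSum (momentumChar k) = ν - dispersion p_k`, a bijection `Λ → Λ̂`);
* **(A.2)–(A.6) on the lattice** (`latticeS_eq`, `latticeS_le_torusGreen`): with the tree's
  zero-mode-removed torus Green function `torusGreen 0 = |Λ|⁻¹∑_{k≠0} D(p_k)⁻¹` (`= R_Λ(ν)`),
  `S_Λ(ν) = ν R_Λ(ν) - |Λ|⁻¹∑_k ν/max(ν, D(p_k)) + |Λ|⁻¹` and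
  `S_Λ(ν) ≤ ν R_Λ(ν) - 3/4 + |Λ|⁻¹` — the printed `S = νR₊ - ½`, `R₊ = R - R₋`, `R₋ ≥ 1/(4ν)`
  (Remark A.1), done mode by mode: `ν/max(ν,D(k)) + ν/max(ν,D(k+π̂)) ≥ 3/2` and `k ↦ k + π̂`
  (the staggered character `stagChar`) is a bijection of `Λ*`;
* **the thermodynamic limit of the constant** (`latticeS_tendsto_fluctS`): for `ν ≥ 3` and
  `ε > 0`, `|S_Λ(ν) - S(ν)| ≤ ε` for all large even `L` — from the tree's
  `torusGreen_tendsto_latticeGreen` (the singular part, Aizenman–Duminil-Copin–Sidoravicius (3.15))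
  and `momentumAverage_uniform_approx` (Riemann sums of the continuous part);
* **Prop. 4.2 (2), first inequality / Remark A.5 (A.28)** (`fluctS_le`):
  `S(ν) ≤ ν R(ν) - 3/4` with `R(ν) = latticeGreen 0` ((A.4); the second inequality
  `≤ ν/(ν-2) - 3/4`, Lemma A.4 (A.23), is `LatticeGreenOriginBound.latticeGreen_zero_le_inv_sub_two`);
  Prop. 4.2 (1) `0 < S(ν) < ∞` (`fluctS_pos`, `integrableOn_fluctIntegrand`: the integrand is
  integrable for `ν ≥ 3` and `≥ 1` on the cube `[1/2,1]^ν`);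
* **Thm. 4.8 (4.42) / Cor. 4.9 with the printed constant** (`uN_chiralLRO_limit`): for the `U(N)`
  model at `β = 0`, `m = 0`, `1 ≤ N ≤ 4`, `ν ≥ 3`, every `ε > 0` and all large even `L`,
  `|Λ|⁻¹∑_x⟨σ_0σ_x⟩_Λ ≥ (1/4ν)(1/K(N) - 2S(ν)/N) - ε`; and (`chiralLRO_of_fluctS_lt`) a uniform
  positive lower bound for all large even `L` as soon as `2S(ν)K(N)/N < 1` — Thm. 4.8's
  "`c₀ > 0` for `ν ≥ ν₀`, where `2S(ν)K(N)/N < 1`".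

WHAT IS NOT DONE HERE.  Prop. 4.2 (3) (`S(ν) → 0`, Lemma A.7: Bessel-`J₀` asymptotics) and the
computer-assisted Prop. 4.2 (4) (`S(4) < 0.35`, …) are not formalised; hence `ν = 4` is not reached —
with the analytic bound `S(ν) ≤ ν/(ν-2) - 3/4` the condition `2S(ν)K(N)/N < 1` holds for
`ν ≥ 11, 11, 13, 20` when `N = 1, 2, 3, 4` (companion file `ComplexSpinChiralLROHighDimension`,
combining `fluctS_le` with `LatticeGreenOriginBound.latticeGreen_zero_le_inv_sub_two`).  The statements
remain finite-volume-uniform ("for all large even `L`"), which is what the printed infinite-volume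
LRO (Thm. 3.18(2), Thm. 3.23) rests on.  Honest framing: `β = 0` complex spin systems on the torus;
nothing about `β > 0`, the continuum, `SU(N)` or the summit's `QCD` conjunct.

WHAT IS PRINTED (locators).  Def. 4.1 (4.1)–(4.3) p. 417; Prop. 4.2 p. 418; Thm. 4.8 with
(4.40)–(4.42) pp. 422–423; Cor. 4.9 p. 423; Appendix (A.1)–(A.6), Remark A.1, p. 424–425;
Remark A.5 (A.28) p. 427; "Proof of Proposition 4.2, (1)–(3). (1) is clear, (2) follows from
Remark A.5 and Proposition A.6" p. 430.

## References

* M. Salmhofer, E. Seiler, *Proof of chiral symmetry breaking in strongly coupled lattice gauge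
  theory*, Commun. Math. Phys. 139 (1991) 395–432, Def. 4.1, Prop. 4.2, Thm. 4.8, Cor. 4.9,
  Appendix (A.1)–(A.6), Remark A.5. [SalmhoferSeiler1991]
* M. Aizenman, H. Duminil-Copin, V. Sidoravicius, Commun. Math. Phys. 334 (2015) 719–742, §3.3
  (3.14)–(3.15) (torus Green function → lattice Green function). [AizenmanDuminilCopinSidoraviciusCMP2015]
* S. Friedli, Y. Velenik, *Statistical Mechanics of Lattice Systems*, CUP 2017, §10.5.2 (10.41)
  (momentum sums as Riemann sums). [FriedliVelenik2017]
-/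

noncomputable section

open MeasureTheory Set Filter Finset
open Literature.Probability.LatticeModels

namespace Literature.MathematicalPhysics.StatisticalMechanics

namespace ComplexSpin

variable {ν L : ℕ}

/-! ### The dictionary: characters of `(ℤ/Lℤ)^ν` and lattice momenta -/

/-- The character `χ_k(x) = ∏_μ e^{2πi k_μ x_μ/L}` of `Λ = (ℤ/Lℤ)^ν` attached to the dual-lattice point
`k` (the tree's `torusChar k`, bundled as an `AddChar`): the momentum `p_k = 2πk/L` of
`latticeMomentum`. [folklore] -/
def momentumChar [NeZero L] (k : TorusSite ν L) : AddChar (TorusSite ν L) ℂ where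
  toFun := torusChar k
  map_zero_eq_one' := torusChar_zero_right k
  map_add_eq_mul' := torusChar_add_right k

section Dictionary

variable [NeZero L]

/-- Unfolding. [folklore] -/
@[simp] private theorem momentumChar_apply (k x : TorusSite ν L) :
    momentumChar k x = torusChar k x := rfl

/-- `χ_0` is the trivial character. [folklore] -/
@[simp] private theorem momentumChar_zero : momentumChar (0 : TorusSite ν L) = 0 := by
  ext x
  simp [momentumChar]

/-- `k ↦ χ_k` is injective (orthogonality of characters). [folklore] -/
private theorem momentumChar_injective : Function.Injective (momentumChar (ν := ν) (L := L)) := by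
  intro k k' h
  have hx : ∀ x, torusChar k x = torusChar k' x := fun x => by
    have := congrArg (fun χ : AddChar (TorusSite ν L) ℂ => χ x) h
    simpa using this
  have hsum : ∑ x, torusChar (k - k') x = (L : ℂ) ^ ν := by
    have : ∀ x, torusChar (k - k') x = 1 := fun x => by
      rw [torusChar_sub_left, ← hx x, torusChar_mul_conj]
    simp [this]
  by_contra hne
  have hne' : k - k' ≠ 0 := sub_ne_zero.2 hne
  rw [sum_torusChar_right, if_neg hne'] at hsum
  exact natCast_pow_ne_zero (d := ν) (L := L) hsum.symm

/-- **`k ↦ χ_k` is a bijection `Λ = (ℤ/Lℤ)^ν → Λ̂`** (injective by orthogonality of characters, and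
`|Λ̂| = |Λ|`): the reciprocal torus `Λ* = (2π/L)ℤ^ν/2πℤ^ν` labels the characters (Friedli–Velenik,
§10.4). [cite: FriedliVelenik2017, §10.4] -/
theorem momentumChar_bijective : Function.Bijective (momentumChar (ν := ν) (L := L)) := by
  rw [Fintype.bijective_iff_injective_and_card]
  exact ⟨momentumChar_injective, (AddChar.card_eq (α := TorusSite ν L)).symm⟩

/-- `χ_k = 0 ↔ k = 0`. [folklore] -/
private theorem momentumChar_eq_zero_iff {k : TorusSite ν L} : momentumChar k = 0 ↔ k = 0 := by
  constructor
  · intro h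
    exact momentumChar_injective (h.trans momentumChar_zero.symm)
  · rintro rfl; exact momentumChar_zero

/-- **`C(k) = ∑_μ cos p_{k,μ} = ν - D(p_k)`**: the series' `cosSum` of the character `χ_k` is the
tree's `ν - dispersion (latticeMomentum L k)` ((4.1): `C(k) = ν - D(k)`).
[cite: SalmhoferSeiler1991, (4.1)] -/
theorem cosSum_momentumChar (hL : 2 ≤ L) (k : TorusSite ν L) :
    cosSum (momentumChar k) = (ν : ℝ) - dispersion (latticeMomentum L k) := by
  haveI : Fact (1 < L) := ⟨hL⟩
  unfold cosSum dispersion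
  have hcard : (ν : ℝ) = ∑ _μ : Fin ν, (1 : ℝ) := by simp
  rw [hcard, ← Finset.sum_sub_distrib]
  refine Finset.sum_congr rfl fun μ _ => ?_
  rw [momentumChar_apply, torusChar_re]
  have : ∑ i, latticeMomentum L k i * (((Pi.single μ (1 : ZMod L) : TorusSite ν L) i).val : ℝ) =
      latticeMomentum L k μ := by
    rw [Finset.sum_eq_single μ]
    · simp [ZMod.val_one]
    · intro i _ hi
      simp [Pi.single_eq_of_ne hi]
    · intro h; exact absurd (Finset.mem_univ μ) h
  rw [this]
  ring

/-- Transport of sums along the dictionary: `∑_χ F(C(χ)) = ∑_k F(ν - D(p_k))`. [folklore] -/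
private theorem sum_addChar_eq_sum_momentum (hL : 2 ≤ L) (F : ℝ → ℝ) :
    ∑ χ : AddChar (TorusSite ν L) ℂ, F (cosSum χ) =
      ∑ k : TorusSite ν L, F ((ν : ℝ) - dispersion (latticeMomentum L k)) := by
  rw [← momentumChar_bijective.sum_comp (fun χ => F (cosSum χ))]
  simp only [cosSum_momentumChar hL]

end Dictionary

/-! ### The complement term `ν/max(ν, D)` and the lattice form of (A.2)–(A.3) -/

/-- The bounded part of the fluctuation integrand: `h_ν(D) = ν/max(ν, D)`, so that
`(ν/D - 1)⁺ = ν/D - h_ν(D)` for `D > 0` (`h_ν = 1` where `C = ν - D ≥ 0`, `= ν/D` where `C < 0`: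
the printed split `S = νR₊ - ½`, `R₊ = R - R₋`, (A.2)–(A.5), mode by mode).  Plumbing.
[folklore] -/
def compTerm (ν : ℕ) (D : ℝ) : ℝ := (ν : ℝ) / max (ν : ℝ) D

/-- `h_ν(0) = 1` (`ν ≥ 1`). [folklore] -/
private theorem compTerm_zero (hν : 1 ≤ ν) : compTerm ν 0 = 1 := by
  have hν' : (0 : ℝ) < ν := by exact_mod_cast hν
  unfold compTerm
  rw [max_eq_left hν'.le, div_self hν'.ne']

/-- **Mode-by-mode split** ((A.2)–(A.5) pointwise): for `C < ν` (i.e. `D = ν - C > 0`),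
`Θ(C)·C/(ν - C) = ν/(ν - C) - h_ν(ν - C)`. [cite: SalmhoferSeiler1991, Appendix (A.2)–(A.5)] -/
theorem modePos_eq (hν : 1 ≤ ν) {c : ℝ} (hc : c < ν) :
    (if 0 < c then c / (ν - c) else 0) = (ν : ℝ) / (ν - c) - compTerm ν (ν - c) := by
  have hν' : (0 : ℝ) < ν := by exact_mod_cast hν
  have hD : 0 < (ν : ℝ) - c := by linarith
  unfold compTerm
  split_ifs with h
  · rw [max_eq_left (by linarith), div_self hν'.ne']
    field_simp
    ring
  · rw [max_eq_right (by linarith)]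
    ring

/-- **Remark A.1 mode by mode**: `h_ν(ν - C) + h_ν(ν + C) ≥ 3/2` for `|C| ≤ ν` — on `{C ≥ 0}` the
first term is `1` and the second `ν/(ν + C) ≥ 1/2`, symmetrically on `{C < 0}`; this is
`R₋ ≥ 1/(4ν)` of (A.6) together with `∫Θ(C) = ½`, before summation.
[cite: SalmhoferSeiler1991, Remark A.1 (A.6)] -/
theorem three_halves_le_compTerm_add (hν : 1 ≤ ν) {c : ℝ} (hc1 : -(ν : ℝ) ≤ c) (hc2 : c ≤ ν) :
    3 / 2 ≤ compTerm ν (ν - c) + compTerm ν (ν + c) := by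
  have hν' : (0 : ℝ) < ν := by exact_mod_cast hν
  unfold compTerm
  rcases le_or_gt 0 c with hc | hc
  · rw [max_eq_left (by linarith), div_self hν'.ne', max_eq_right (by linarith)]
    have h2 : 1 / 2 ≤ (ν : ℝ) / (ν + c) := by
      rw [div_le_div_iff₀ (by norm_num) (by linarith)]
      linarith
    linarith
  · rw [max_eq_right (by linarith), max_eq_left (by linarith), div_self hν'.ne']
    have h2 : 1 / 2 ≤ (ν : ℝ) / (ν - c) := by
      rw [div_le_div_iff₀ (by norm_num) (by linarith)]
      linarith
    linarith

section Lattice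

variable [NeZero L]

/-- **(A.2)–(A.3) on the lattice, character form**:
`|Λ| S_Λ(ν) = ν ∑_{χ≠0} 1/D(χ) - ∑_χ h_ν(D(χ)) + 1` (`D(χ) = ν - C(χ)`; the `+1` is the zero mode,
`h_ν(D(0)) = h_ν(0) = 1`, present in the second sum and absent from `S_Λ` and the first sum).
[cite: SalmhoferSeiler1991, Appendix (A.2)–(A.3)] -/
theorem card_mul_latticeS_eq (hν : 1 ≤ ν) :
    (Fintype.card (TorusSite ν L) : ℝ) * latticeS ν L =
      ν * (∑ χ : AddChar (TorusSite ν L) ℂ, if χ = 0 then 0 else 1 / ((ν : ℝ) - cosSum χ))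
        - (∑ χ : AddChar (TorusSite ν L) ℂ, compTerm ν (ν - cosSum χ)) + 1 := by
  have hcard : (Fintype.card (TorusSite ν L) : ℝ) ≠ 0 := Nat.cast_ne_zero.2 Fintype.card_ne_zero
  unfold latticeS
  rw [← mul_assoc, mul_inv_cancel₀ hcard, one_mul, Finset.sum_filter]
  -- rewrite each mode
  have hmode : ∀ χ : AddChar (TorusSite ν L) ℂ,
      (if χ ≠ 0 ∧ 0 < cosSum χ then cosSum χ / (ν - cosSum χ) else 0) =
        (if χ = 0 then 0 else (ν : ℝ) / (ν - cosSum χ) - compTerm ν (ν - cosSum χ)) := by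
    intro χ
    by_cases h0 : χ = 0
    · simp [h0]
    · rw [if_neg h0, ← modePos_eq hν (cosSum_lt_of_ne_zero h0)]
      simp [h0]
  simp_rw [hmode]
  -- split the `if`
  have hsplit : ∀ χ : AddChar (TorusSite ν L) ℂ,
      (if χ = 0 then 0 else (ν : ℝ) / (ν - cosSum χ) - compTerm ν (ν - cosSum χ)) =
        ν * (if χ = 0 then 0 else 1 / ((ν : ℝ) - cosSum χ)) - compTerm ν (ν - cosSum χ)
          + (if χ = 0 then 1 else 0) := by
    intro χ
    by_cases h0 : χ = 0
    · rw [if_pos h0, if_pos h0, if_pos h0, h0, cosSum_zero, sub_self, compTerm_zero hν]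
      ring
    · rw [if_neg h0, if_neg h0, if_neg h0]
      ring
  simp_rw [hsplit]
  rw [Finset.sum_add_distrib, Finset.sum_sub_distrib, ← Finset.mul_sum, Finset.sum_ite_eq']
  simp

/-- **Remark A.1 summed over the dual torus** (even `L`): `∑_χ h_ν(D(χ)) ≥ (3/4)|Λ̂|`, by the
bijection `χ ↦ ε + χ` (`C(ε + χ) = -C(χ)`, the fold `k ↦ k + π̂` of (A.5)/(4.14)) and
`h_ν(ν - C) + h_ν(ν + C) ≥ 3/2`. [cite: SalmhoferSeiler1991, Remark A.1 (A.5)–(A.6)] -/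
theorem sum_compTerm_ge (hν : 1 ≤ ν) (hL : 2 ∣ L) :
    3 / 4 * (Fintype.card (AddChar (TorusSite ν L) ℂ) : ℝ) ≤
      ∑ χ : AddChar (TorusSite ν L) ℂ, compTerm ν (ν - cosSum χ) := by
  set ε := stagChar (ν := ν) hL with hε
  have hshift : ∑ χ : AddChar (TorusSite ν L) ℂ, compTerm ν (ν - cosSum χ) =
      ∑ χ : AddChar (TorusSite ν L) ℂ, compTerm ν (ν + cosSum χ) := by
    rw [← Equiv.sum_comp (Equiv.addLeft ε) (fun χ => compTerm ν (ν - cosSum χ))]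
    refine Finset.sum_congr rfl fun χ _ => ?_
    simp only [Equiv.coe_addLeft, hε, cosSum_stagChar_add hL χ, sub_neg_eq_add]
  have hsum : 2 * ∑ χ : AddChar (TorusSite ν L) ℂ, compTerm ν (ν - cosSum χ) =
      ∑ χ : AddChar (TorusSite ν L) ℂ, (compTerm ν (ν - cosSum χ) + compTerm ν (ν + cosSum χ)) := by
    rw [two_mul, Finset.sum_add_distrib, ← hshift]
  have hbound : ∑ _χ : AddChar (TorusSite ν L) ℂ, (3 / 2 : ℝ) ≤
      ∑ χ : AddChar (TorusSite ν L) ℂ, (compTerm ν (ν - cosSum χ) + compTerm ν (ν + cosSum χ)) :=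
    Finset.sum_le_sum fun χ _ =>
      three_halves_le_compTerm_add hν (neg_le_cosSum χ) (cosSum_le χ)
  rw [Finset.sum_const, nsmul_eq_mul, Finset.card_univ] at hbound
  linarith

/-- **Remark A.5 in finite volume, character form**:
`|Λ| S_Λ(ν) ≤ ν ∑_{χ≠0} 1/D(χ) - (3/4)|Λ| + 1`. [cite: SalmhoferSeiler1991, Remark A.5 (A.28) with (A.2)–(A.6)] -/
theorem card_mul_latticeS_le (hν : 1 ≤ ν) (hL : 2 ∣ L) :
    (Fintype.card (TorusSite ν L) : ℝ) * latticeS ν L ≤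
      ν * (∑ χ : AddChar (TorusSite ν L) ℂ, if χ = 0 then 0 else 1 / ((ν : ℝ) - cosSum χ))
        - 3 / 4 * (Fintype.card (TorusSite ν L) : ℝ) + 1 := by
  rw [card_mul_latticeS_eq hν]
  have h := sum_compTerm_ge (ν := ν) hν hL
  rw [AddChar.card_eq] at h
  linarith

end Lattice

/-! ### Momentum form: `S_Λ(ν) = ν R_Λ(ν) - |Λ|⁻¹∑_k h_ν(D(p_k)) + |Λ|⁻¹` -/

section Momentum

variable [NeZero L]

/-- The singular part in momentum form: `∑_{χ≠0} 1/D(χ) = L^ν · torusGreen 0`, the tree's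
zero-mode-removed torus Green function at the origin (`R_Λ(ν)` of Salmhofer–Seiler, the lattice
version of (A.4)). [cite: SalmhoferSeiler1991, Appendix (A.4)] -/
theorem sum_inv_dispersion_eq_torusGreen (hL : 2 ≤ L) :
    (∑ χ : AddChar (TorusSite ν L) ℂ, if χ = 0 then 0 else 1 / ((ν : ℝ) - cosSum χ)) =
      (L : ℝ) ^ ν * torusGreen (0 : TorusSite ν L) := by
  rw [← momentumChar_bijective.sum_comp
    (fun χ : AddChar (TorusSite ν L) ℂ => if χ = 0 then 0 else 1 / ((ν : ℝ) - cosSum χ))]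
  simp only [momentumChar_eq_zero_iff, cosSum_momentumChar hL, sub_sub_cancel]
  have hL0 : (L : ℝ) ^ ν ≠ 0 := pow_ne_zero ν (by exact_mod_cast NeZero.ne L)
  unfold torusGreen
  rw [mul_div_cancel₀ _ hL0]
  simp only [Pi.zero_apply, ZMod.val_zero, Nat.cast_zero, mul_zero, Finset.sum_const_zero,
    Real.cos_zero]
  rw [← Finset.sum_erase_add _ _ (Finset.mem_univ (0 : TorusSite ν L)), if_pos rfl, add_zero]
  exact Finset.sum_congr rfl fun k hk => by rw [if_neg (Finset.ne_of_mem_erase hk)]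

/-- The bounded part in momentum form: `∑_χ h_ν(D(χ)) = ∑_k h_ν(D(p_k))`. [folklore] -/
private theorem sum_compTerm_eq_momentum (hL : 2 ≤ L) :
    ∑ χ : AddChar (TorusSite ν L) ℂ, compTerm ν (ν - cosSum χ) =
      ∑ k : TorusSite ν L, compTerm ν (dispersion (latticeMomentum L k)) := by
  rw [sum_addChar_eq_sum_momentum hL (fun c => compTerm ν (ν - c))]
  simp only [sub_sub_cancel]

/-- **(A.2)–(A.3) on the lattice**: `S_Λ(ν) = ν R_Λ(ν) - L^{-ν}∑_k h_ν(D(p_k)) + L^{-ν}` with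
`R_Λ(ν) = torusGreen 0 = L^{-ν}∑_{k≠0} D(p_k)⁻¹`. [cite: SalmhoferSeiler1991, Appendix (A.2)–(A.3)] -/
theorem latticeS_eq (hν : 1 ≤ ν) (hL : 2 ≤ L) :
    latticeS ν L = ν * torusGreen (0 : TorusSite ν L)
      - ((L : ℝ) ^ ν)⁻¹ * ∑ k : TorusSite ν L, compTerm ν (dispersion (latticeMomentum L k))
      + ((L : ℝ) ^ ν)⁻¹ := by
  have h := card_mul_latticeS_eq (ν := ν) (L := L) hν
  rw [sum_inv_dispersion_eq_torusGreen hL, sum_compTerm_eq_momentum hL, card_torusSite] at h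
  push_cast at h
  have hL0 : (L : ℝ) ^ ν ≠ 0 := pow_ne_zero ν (by exact_mod_cast NeZero.ne L)
  field_simp
  linear_combination h

/-- **Remark A.5 (A.28) in finite volume**: on the even torus `(ℤ/Lℤ)^ν`,
`S_Λ(ν) ≤ ν R_Λ(ν) - 3/4 + L^{-ν}` (`R_Λ = torusGreen 0`), the lattice version of
`S(ν) ≤ νR(ν) - 3/4`. [cite: SalmhoferSeiler1991, Remark A.5 (A.28)] -/
theorem latticeS_le_torusGreen (hν : 1 ≤ ν) (hL : Even L) (hL2 : 2 ≤ L) :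
    latticeS ν L ≤ ν * torusGreen (0 : TorusSite ν L) - 3 / 4 + ((L : ℝ) ^ ν)⁻¹ := by
  have h := card_mul_latticeS_le (ν := ν) (L := L) hν hL.two_dvd
  rw [sum_inv_dispersion_eq_torusGreen hL2, card_torusSite] at h
  push_cast at h
  have hL0 : (0 : ℝ) < (L : ℝ) ^ ν := pow_pos (by exact_mod_cast Nat.pos_of_ne_zero (NeZero.ne L)) ν
  rw [← sub_nonneg] at h ⊢
  have : ν * torusGreen (0 : TorusSite ν L) - 3 / 4 + ((L : ℝ) ^ ν)⁻¹ - latticeS ν L =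
      ((L : ℝ) ^ ν)⁻¹ * (ν * ((L : ℝ) ^ ν * torusGreen (0 : TorusSite ν L))
        - 3 / 4 * (L : ℝ) ^ ν + 1 - (L : ℝ) ^ ν * latticeS ν L) := by
    field_simp
  rw [this]
  exact mul_nonneg (inv_nonneg.2 hL0.le) h

/-- The momentum average of the bounded part is at least `3/4` (even `L`):
`L^{-ν}∑_k h_ν(D(p_k)) ≥ 3/4`. [cite: SalmhoferSeiler1991, Remark A.1 (A.6)] -/
theorem momentumAverage_compTerm_ge (hν : 1 ≤ ν) (hL : Even L) (hL2 : 2 ≤ L) :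
    3 / 4 ≤ ((L : ℝ) ^ ν)⁻¹ * ∑ k : TorusSite ν L, compTerm ν (dispersion (latticeMomentum L k)) := by
  have h := sum_compTerm_ge (ν := ν) (L := L) hν hL.two_dvd
  rw [sum_compTerm_eq_momentum hL2, AddChar.card_eq, card_torusSite] at h
  push_cast at h
  have hL0 : (0 : ℝ) < (L : ℝ) ^ ν := pow_pos (by exact_mod_cast Nat.pos_of_ne_zero (NeZero.ne L)) ν
  rw [le_inv_mul_iff₀ hL0]
  linarith

end Momentum

/-! ### The printed constant `S(ν)` (4.3) and its decomposition (A.2)–(A.3) -/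

/-- **Definition 4.1, (4.3): the fluctuation function**
`S(ν) = ∫_{ℬ⁺_ν} d^νk/(2π)^ν C(k)/D(k)`, `C(k) = ∑_μ cos k_μ = ν - D(k)` (4.1),
`ℬ⁺_ν = {k ∈ [-π,π]^ν : C(k) > 0}` (4.2); written as `(2π)^{-ν}∫_{[-π,π]^ν} (ν/D(k) - 1)⁺ d^νk`
(`Θ(C)C/D = (ν/D - 1)⁺`).  The integrand is `O(|k|^{-2})` at the origin, integrable for `ν ≥ 3`
(Prop. 4.2 (1)); for `ν ≤ 2` the Bochner integral is the junk value `0`.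
[cite: SalmhoferSeiler1991, Def. 4.1 (4.3)] -/
def fluctS (ν : ℕ) : ℝ :=
  (∫ p in brillouin ν, max ((ν : ℝ) / dispersion p - 1) 0) / ((2 * Real.pi) ^ ν)

/-- **Prop. 4.2 (1), lower half**: `0 ≤ S(ν)`. [cite: SalmhoferSeiler1991, Prop. 4.2 (1)] -/
theorem fluctS_nonneg (ν : ℕ) : 0 ≤ fluctS ν :=
  div_nonneg (setIntegral_nonneg (measurableSet_brillouin ν) fun p _ => le_max_right _ _)
    (by positivity)

/-- **Prop. 4.2 (1), "`S(ν) < ∞`"**: the integrand `(ν/D - 1)⁺ ≤ ν/D` of (4.3) is integrable on the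
Brillouin zone for `ν ≥ 3`. [cite: SalmhoferSeiler1991, Prop. 4.2 (1)] -/
theorem integrableOn_fluctIntegrand (hν : 3 ≤ ν) :
    IntegrableOn (fun p : Fin ν → ℝ => max ((ν : ℝ) / dispersion p - 1) 0) (brillouin ν) := by
  have hB := measurableSet_brillouin ν
  have hinv : IntegrableOn (fun p : Fin ν → ℝ => 1 / dispersion p) (brillouin ν) :=
    (integrable_indicator_iff hB).1 (integrable_indicator_inv_dispersion ν hν)
  refine (hinv.const_mul (ν : ℝ)).mono' ?_ (ae_of_all _ fun p => ?_)
  · exact (((measurable_const.div (continuous_dispersion ν).measurable).sub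
      measurable_const).max measurable_const).aestronglyMeasurable
  · rw [Real.norm_eq_abs, abs_of_nonneg (le_max_right _ _), mul_one_div]
    exact max_le (by linarith) (div_nonneg (Nat.cast_nonneg ν) (dispersion_nonneg p))

/-- **Prop. 4.2 (1), "`0 < S(ν)`"** (`ν ≥ 3`): the integrand is `≥ 1` on the cube `[1/2, 1]^ν`
(there `0 < D ≤ ν/2`). [cite: SalmhoferSeiler1991, Prop. 4.2 (1)] -/
theorem fluctS_pos (hν : 3 ≤ ν) : 0 < fluctS ν := by
  have hν1 : 1 ≤ ν := by omega
  have hνpos : (0 : ℝ) < ν := by exact_mod_cast hν1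
  unfold fluctS
  refine div_pos ?_ (by positivity)
  set f : (Fin ν → ℝ) → ℝ := fun p => max ((ν : ℝ) / dispersion p - 1) 0 with hf
  set Q : Set (Fin ν → ℝ) := Set.pi Set.univ fun _ => Set.Icc (1 / 2 : ℝ) 1 with hQ
  have hQB : Q ⊆ brillouin ν := Set.pi_mono fun i _ =>
    Set.Icc_subset_Icc (by linarith [Real.pi_gt_three]) (by linarith [Real.pi_gt_three])
  have hQmeas : MeasurableSet Q := MeasurableSet.univ_pi fun _ => measurableSet_Icc
  -- on `Q`, `f ≥ 1`
  have hfQ : ∀ p ∈ Q, (1 : ℝ) ≤ f p := by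
    intro p hp
    have hpi : ∀ i, p i ∈ Set.Icc (1 / 2 : ℝ) 1 := fun i => hp i (Set.mem_univ i)
    have hp0 : p ≠ 0 := by
      intro h
      have := (hpi ⟨0, by omega⟩).1
      rw [h, Pi.zero_apply] at this
      linarith
    have hDpos : 0 < dispersion p := dispersion_pos_of_mem_brillouin (hQB hp) hp0
    have hD : dispersion p ≤ ν / 2 := by
      unfold dispersion
      have hterm : ∀ i, 1 - Real.cos (p i) ≤ 1 / 2 := fun i => by
        have h1 := Real.one_sub_sq_div_two_le_cos (x := p i)
        have hsq : (p i) ^ 2 ≤ 1 := by nlinarith [(hpi i).1, (hpi i).2]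
        linarith
      calc ∑ i, (1 - Real.cos (p i)) ≤ ∑ _i : Fin ν, (1 / 2 : ℝ) :=
            Finset.sum_le_sum fun i _ => hterm i
        _ = ν / 2 := by simp [Finset.sum_const, Finset.card_univ, Fintype.card_fin]; ring
    have h2 : (2 : ℝ) ≤ ν / dispersion p := by
      rw [le_div_iff₀ hDpos]; linarith
    simp only [hf]
    exact le_trans (by linarith) (le_max_left _ _)
  -- `vol Q = (1/2)^ν`
  have hvolQ : volume Q = ENNReal.ofReal ((1 / 2 : ℝ) ^ ν) := by
    rw [hQ, volume_pi_pi]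
    simp only [Real.volume_Icc, Finset.prod_const, Finset.card_univ, Fintype.card_fin]
    rw [ENNReal.ofReal_pow (by norm_num)]
    norm_num
  have hvolQ_ne_top : volume Q ≠ ⊤ := by rw [hvolQ]; exact ENNReal.ofReal_ne_top
  have hfint := integrableOn_fluctIntegrand hν
  calc (0 : ℝ) < (1 / 2 : ℝ) ^ ν := by positivity
    _ = volume.real Q • (1 : ℝ) := by
        rw [smul_eq_mul, mul_one, measureReal_def, hvolQ, ENNReal.toReal_ofReal (by positivity)]
    _ ≤ ∫ p in Q, f p :=
        setIntegral_ge_of_const_le hQmeas hvolQ_ne_top hfQ (hfint.mono_set hQB)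
    _ ≤ ∫ p in brillouin ν, f p :=
        setIntegral_mono_set hfint (ae_of_all _ fun p => le_max_right _ _)
          (Eventually.of_forall hQB)

/-- The bounded part of the integrand is continuous in the momentum. [folklore] -/
private theorem continuous_compTerm_dispersion (hν : 1 ≤ ν) :
    Continuous fun p : Fin ν → ℝ => compTerm ν (dispersion p) := by
  have hν' : (0 : ℝ) < ν := by exact_mod_cast hν
  unfold compTerm
  exact continuous_const.div (continuous_const.max (continuous_dispersion ν))
    fun p => (lt_of_lt_of_le hν' (le_max_left _ _)).ne'

/-- The bounded part is `2π`-periodic in each momentum coordinate. [folklore] -/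
private theorem compTerm_dispersion_periodic (p : Fin ν → ℝ) (n : Fin ν → ℤ) :
    compTerm ν (dispersion fun i => p i + 2 * Real.pi * (n i : ℝ)) = compTerm ν (dispersion p) := by
  have h : dispersion (fun i => p i + 2 * Real.pi * (n i : ℝ)) = dispersion p := by
    unfold dispersion
    refine Finset.sum_congr rfl fun i _ => ?_
    dsimp only
    rw [show p i + 2 * Real.pi * (n i : ℝ) = p i + (n i : ℝ) * (2 * Real.pi) by ring,
      Real.cos_add_int_mul_two_pi]
  rw [h]

/-- The mode-by-mode split at the level of the Brillouin-zone integrand: off the origin,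
`(ν/D(p) - 1)⁺ = ν · D(p)⁻¹ - h_ν(D(p))`. [cite: SalmhoferSeiler1991, Appendix (A.2)–(A.3)] -/
theorem posPart_eq_of_dispersion_pos (hν : 1 ≤ ν) {p : Fin ν → ℝ} (hp : 0 < dispersion p) :
    max ((ν : ℝ) / dispersion p - 1) 0 = ν * (1 / dispersion p) - compTerm ν (dispersion p) := by
  have hν' : (0 : ℝ) < ν := by exact_mod_cast hν
  unfold compTerm
  rcases le_or_gt (dispersion p) ν with hD | hD
  · rw [max_eq_left (a := (ν : ℝ)) hD, div_self hν'.ne', max_eq_left]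
    · ring
    · rw [sub_nonneg, le_div_iff₀ hp]; linarith
  · rw [max_eq_right (a := (ν : ℝ)) hD.le, max_eq_right]
    · ring
    · rw [sub_nonpos, div_le_iff₀ hp]; linarith

/-- **(A.2)–(A.3): `S(ν) = ν R(ν) - (2π)^{-ν}∫_{[-π,π]^ν} h_ν(D)`** for `ν ≥ 3`, with
`R(ν) = latticeGreen 0 = ∫ d^νk/((2π)^ν D(k))` (A.4) (the printed `S = νR₊ - ½ = νR - νR₋ - ½`;
here `(2π)^{-ν}∫h_ν = ½ + νR₋` since `h_ν = 1` on `{C ≥ 0}` and `= ν/D` on `{C < 0}`).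
[cite: SalmhoferSeiler1991, Appendix (A.2)–(A.4)] -/
theorem fluctS_eq (hν : 3 ≤ ν) :
    fluctS ν = ν * latticeGreen (0 : Site ν)
      - (∫ p in brillouin ν, compTerm ν (dispersion p)) / ((2 * Real.pi) ^ ν) := by
  have hν1 : 1 ≤ ν := by omega
  have hB : MeasurableSet (brillouin ν) := measurableSet_brillouin ν
  haveI : Nonempty (Fin ν) := ⟨⟨0, by omega⟩⟩
  -- `D > 0` a.e. on the zone
  have hpos : ∀ᵐ p ∂(volume.restrict (brillouin ν)), 0 < dispersion p := by
    have h_ne : ∀ᵐ p ∂(volume.restrict (brillouin ν)), p ≠ (0 : Fin ν → ℝ) := by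
      have h0 : volume.restrict (brillouin ν) {(0 : Fin ν → ℝ)} = 0 := by
        rw [Measure.restrict_apply (measurableSet_singleton 0)]
        exact measure_mono_null Set.inter_subset_left (measure_singleton 0)
      filter_upwards [measure_eq_zero_iff_ae_notMem.1 h0] with p hp
      simpa using hp
    filter_upwards [ae_restrict_mem hB, h_ne] with p hp hp0
    exact dispersion_pos_of_mem_brillouin hp hp0
  have hinv : IntegrableOn (fun p : Fin ν → ℝ => 1 / dispersion p) (brillouin ν) :=
    (integrable_indicator_iff hB).1 (integrable_indicator_inv_dispersion ν hν)
  have hcomp : IntegrableOn (fun p : Fin ν → ℝ => compTerm ν (dispersion p)) (brillouin ν) :=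
    (continuous_compTerm_dispersion hν1).continuousOn.integrableOn_compact (isCompact_brillouin ν)
  have hcongr : ∫ p in brillouin ν, max ((ν : ℝ) / dispersion p - 1) 0 =
      ∫ p in brillouin ν, ((ν : ℝ) * (1 / dispersion p) - compTerm ν (dispersion p)) :=
    integral_congr_ae (by
      filter_upwards [hpos] with p hp
      exact posPart_eq_of_dispersion_pos hν1 hp)
  have hG : latticeGreen (0 : Site ν) = (∫ p in brillouin ν, 1 / dispersion p) / (2 * Real.pi) ^ ν := by
    unfold latticeGreen
    simp only [Pi.zero_apply, Int.cast_zero, mul_zero, Finset.sum_const_zero, Real.cos_zero]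
  unfold fluctS
  rw [hcongr, integral_sub (hinv.const_mul _) hcomp, integral_const_mul, hG]
  field_simp

/-! ### The thermodynamic limit `S_Λ(ν) → S(ν)` -/

/-- `Torus.proj L 0 = 0`. [folklore] -/
private theorem torus_proj_zero (L : ℕ) : Torus.proj L (0 : Site ν) = 0 := by
  funext i
  simp [Torus.proj]

/-- Riemann sums of the bounded part: for `ε > 0` and all large even `L`,
`|L^{-ν}∑_k h_ν(D(p_k)) - (2π)^{-ν}∫_{[-π,π]^ν} h_ν(D)| ≤ ε` (the tree's
`momentumAverage_uniform_approx`). [cite: FriedliVelenik2017, §10.5.2 (10.41)] -/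
theorem momentumAverage_compTerm_approx (hν : 1 ≤ ν) {ε : ℝ} (hε : 0 < ε) :
    ∃ L₀ : ℕ, ∀ (L : ℕ) [NeZero L], Even L → L₀ ≤ L →
      |((L : ℝ) ^ ν)⁻¹ * ∑ k : TorusSite ν L, compTerm ν (dispersion (latticeMomentum L k))
        - (∫ p in brillouin ν, compTerm ν (dispersion p)) / ((2 * Real.pi) ^ ν)| ≤ ε := by
  have hcont := continuous_compTerm_dispersion hν
  obtain ⟨L₀, hL₀⟩ := momentumAverage_uniform_approx (d := ν) (Y := Unit) (E := ℝ)
    (C := Set.univ) isCompact_univ (G := fun p _ => compTerm ν (dispersion p))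
    ((hcont.comp continuous_fst).continuousOn)
    (fun p _ n => compTerm_dispersion_periodic p n) hε
  refine ⟨L₀, fun L _ hLe hL => ?_⟩
  have h := hL₀ L hL hLe () (Set.mem_univ _)
  rw [Real.norm_eq_abs] at h
  simp only [smul_eq_mul] at h
  push_cast at h
  rwa [div_eq_inv_mul]

/-- **The thermodynamic limit of the constant**: for `ν ≥ 3` and `ε > 0` there is `L₀` with
`|S_Λ(ν) - S(ν)| ≤ ε` for all even `L ≥ L₀` — the passage from (4.41) (finite volume, `S_Λ`) to
(4.42) with the printed `S(ν)`, via `R_Λ → R` (Aizenman–Duminil-Copin–Sidoravicius (3.15), the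
tree's `torusGreen_tendsto_latticeGreen`) and the Riemann sums of the continuous part.
[cite: SalmhoferSeiler1991, Thm. 4.8 ((4.40)–(4.42)) with Def. 4.1 (4.3)] -/
theorem latticeS_tendsto_fluctS (hν : 3 ≤ ν) {ε : ℝ} (hε : 0 < ε) :
    ∃ L₀ : ℕ, ∀ (L : ℕ) [NeZero L], Even L → L₀ ≤ L → |latticeS ν L - fluctS ν| ≤ ε := by
  have hν1 : 1 ≤ ν := by omega
  have hνpos : (0 : ℝ) < ν := by exact_mod_cast hν1
  obtain ⟨L₁, hL₁⟩ := torusGreen_tendsto_latticeGreen (d := ν) hν (0 : Site ν)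
    (ε := ε / (3 * ν)) (by positivity)
  obtain ⟨L₂, hL₂⟩ := momentumAverage_compTerm_approx (ν := ν) hν1 (ε := ε / 3) (by positivity)
  obtain ⟨L₃, hL₃⟩ := exists_nat_gt (3 / ε)
  refine ⟨max (max L₁ L₂) (max L₃ 2), fun L _ hL hLe => ?_⟩
  have hL1 : L₁ ≤ L := le_trans (le_max_left _ _) (le_trans (le_max_left _ _) hLe)
  have hL2 : L₂ ≤ L := le_trans (le_max_right _ _) (le_trans (le_max_left _ _) hLe)
  have hL3 : L₃ ≤ L := le_trans (le_max_left _ _) (le_trans (le_max_right _ _) hLe)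
  have hL4 : 2 ≤ L := le_trans (le_max_right _ _) (le_trans (le_max_right _ _) hLe)
  have hG := hL₁ L hL hL1
  rw [torus_proj_zero] at hG
  have hH := hL₂ L hL hL2
  -- the zero-mode term `L^{-ν} ≤ 1/L ≤ ε/3`
  have hLpos : (0 : ℝ) < L := by exact_mod_cast (show 0 < L by omega)
  have hinv : ((L : ℝ) ^ ν)⁻¹ ≤ ε / 3 := by
    have h1 : (L : ℝ) ≤ (L : ℝ) ^ ν := by
      calc (L : ℝ) = (L : ℝ) ^ 1 := (pow_one _).symm
        _ ≤ (L : ℝ) ^ ν := pow_le_pow_right₀ (by exact_mod_cast (show 1 ≤ L by omega)) hν1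
    have h2 : (3 : ℝ) / ε < L := lt_of_lt_of_le hL₃ (by exact_mod_cast hL3)
    have h3 : ((L : ℝ) ^ ν)⁻¹ ≤ (L : ℝ)⁻¹ := inv_anti₀ hLpos h1
    have h4 : (L : ℝ)⁻¹ ≤ ε / 3 := by
      rw [inv_eq_one_div, div_le_div_iff₀ hLpos (by norm_num : (0 : ℝ) < 3)]
      have := (div_lt_iff₀ hε).1 h2
      linarith
    exact h3.trans h4
  rw [latticeS_eq hν1 hL4, fluctS_eq hν]
  have hG' : |(ν : ℝ) * (torusGreen (0 : TorusSite ν L) - latticeGreen (0 : Site ν))| ≤ ε / 3 := by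
    rw [abs_mul, abs_of_pos hνpos]
    calc (ν : ℝ) * |torusGreen (0 : TorusSite ν L) - latticeGreen (0 : Site ν)|
        ≤ ν * (ε / (3 * ν)) := mul_le_mul_of_nonneg_left hG hνpos.le
      _ = ε / 3 := by field_simp
  have hI : |((L : ℝ) ^ ν)⁻¹| ≤ ε / 3 := by
    rw [abs_of_nonneg (inv_nonneg.2 (pow_nonneg hLpos.le ν))]; exact hinv
  calc |ν * torusGreen (0 : TorusSite ν L)
        - ((L : ℝ) ^ ν)⁻¹ * ∑ k : TorusSite ν L, compTerm ν (dispersion (latticeMomentum L k))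
        + ((L : ℝ) ^ ν)⁻¹
        - (ν * latticeGreen (0 : Site ν)
          - (∫ p in brillouin ν, compTerm ν (dispersion p)) / (2 * Real.pi) ^ ν)|
      = |ν * (torusGreen (0 : TorusSite ν L) - latticeGreen (0 : Site ν))
          + -(((L : ℝ) ^ ν)⁻¹ * ∑ k : TorusSite ν L, compTerm ν (dispersion (latticeMomentum L k))
              - (∫ p in brillouin ν, compTerm ν (dispersion p)) / (2 * Real.pi) ^ ν)
          + ((L : ℝ) ^ ν)⁻¹| := by ring_nf
    _ ≤ |ν * (torusGreen (0 : TorusSite ν L) - latticeGreen (0 : Site ν))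
          + -(((L : ℝ) ^ ν)⁻¹ * ∑ k : TorusSite ν L, compTerm ν (dispersion (latticeMomentum L k))
              - (∫ p in brillouin ν, compTerm ν (dispersion p)) / (2 * Real.pi) ^ ν)|
          + |((L : ℝ) ^ ν)⁻¹| := abs_add_le _ _
    _ ≤ (|ν * (torusGreen (0 : TorusSite ν L) - latticeGreen (0 : Site ν))|
          + |-(((L : ℝ) ^ ν)⁻¹ * ∑ k : TorusSite ν L, compTerm ν (dispersion (latticeMomentum L k))
              - (∫ p in brillouin ν, compTerm ν (dispersion p)) / (2 * Real.pi) ^ ν)|)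
          + |((L : ℝ) ^ ν)⁻¹| := by gcongr; exact abs_add_le _ _
    _ ≤ (ε / 3 + ε / 3) + ε / 3 := by
        gcongr
        rwa [abs_neg]
    _ = ε := by ring

/-! ### Prop. 4.2 (2): `S(ν) ≤ ν R(ν) - 3/4` -/

/-- `(2π)^{-ν}∫_{[-π,π]^ν} h_ν(D) ≥ 3/4` (`= ½ + νR₋(ν)` with `R₋ ≥ 1/(4ν)`, Remark A.1 (A.6)), as the
limit of the lattice averages `≥ 3/4`. [cite: SalmhoferSeiler1991, Remark A.1 (A.6)] -/
theorem integral_compTerm_ge (hν : 1 ≤ ν) :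
    3 / 4 ≤ (∫ p in brillouin ν, compTerm ν (dispersion p)) / ((2 * Real.pi) ^ ν) := by
  refine le_of_forall_pos_le_add fun ε hε => ?_
  obtain ⟨L₀, hL₀⟩ := momentumAverage_compTerm_approx (ν := ν) hν hε
  -- an even `L ≥ max L₀ 2`
  set L : ℕ := 2 * (max L₀ 2) with hLdef
  haveI : NeZero L := ⟨by rw [hLdef]; omega⟩
  have hLe : L₀ ≤ L := by rw [hLdef]; omega
  have hL2 : 2 ≤ L := by rw [hLdef]; omega
  have hev : Even L := ⟨max L₀ 2, by rw [hLdef]; ring⟩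
  have h1 := hL₀ L hev hLe
  have h2 := momentumAverage_compTerm_ge (ν := ν) (L := L) hν hev hL2
  have h3 := (abs_le.1 h1).2
  linarith

/-- **Prop. 4.2 (2), first inequality (Remark A.5, (A.28)): `S(ν) ≤ ν R(ν) - 3/4`** for `ν ≥ 3`,
with `R(ν) = latticeGreen 0 = ∫ d^νk/((2π)^ν D(k))` (A.4).  [Together with Lemma A.4 (2),
`R(ν) ≤ 1/(ν - 2)` (`LatticeGreenOriginBound.latticeGreen_zero_le_inv_sub_two`), this is the
printed `S(ν) ≤ νR(ν) - 3/4 ≤ ν/(ν-2) - 3/4`.] [cite: SalmhoferSeiler1991, Prop. 4.2 (2) (4.4) and Remark A.5 (A.28)] -/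
theorem fluctS_le (hν : 3 ≤ ν) : fluctS ν ≤ ν * latticeGreen (0 : Site ν) - 3 / 4 := by
  rw [fluctS_eq hν]
  have h := integral_compTerm_ge (ν := ν) (by omega)
  linarith

/-! ### Thm. 4.8 (4.42) and Cor. 4.9 with the printed constant -/

/-- **Thm. 4.8 (4.42) with the printed `S(ν)`**: for a complex spin system with `B = exp(NW)` to
order `N`, `w₁ = 1`, `w_k ≥ 0` (Thm. 4.8's hypotheses), `ν ≥ 3`, at `m = 0`: for every `ε > 0` and
all large even `L`, `|Λ|⁻¹∑_x⟨σ_0σ_x⟩_Λ ≥ (1/4ν)(1/K(N) - 2S(ν)/N) - ε` — the uniform finite-volume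
content of "`c₀ ≥ (1/4ν)(1/K(N) - 2S(ν)/N)`" (4.42) (`c₀ = lim |Λ|⁻¹∑_x⟨σ_0σ_x⟩`, Thm. 3.23).
[cite: SalmhoferSeiler1991, Thm. 4.8 (4.42)] -/
theorem chiralLRO_expect_limit (hν : 3 ≤ ν) {N : ℕ} (hN : 1 ≤ N)
    {a w : ℕ → ℝ} (hlog : HasLog N a w) (ha0 : a 0 = 1) (hw1 : w 1 = 1)
    (hw : ∀ k, 2 ≤ k → k ≤ N → 0 ≤ w k) {ε : ℝ} (hε : 0 < ε) :
    ∃ L₀ : ℕ, ∀ (L : ℕ) [NeZero L], Even L → L₀ ≤ L →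
      1 / (4 * ν) * (1 / sdK N w - 2 * fluctS ν / N) - ε ≤
        (Fintype.card (TorusSite ν L) : ℝ)⁻¹ *
          ∑ x : TorusSite ν L, expect N 0 a (MvPolynomial.X (0 : TorusSite ν L) * MvPolynomial.X x) := by
  have hν1 : 1 ≤ ν := by omega
  have hνpos : (0 : ℝ) < ν := by exact_mod_cast hν1
  have hNpos : (0 : ℝ) < N := by exact_mod_cast hN
  obtain ⟨L₀, hL₀⟩ := latticeS_tendsto_fluctS (ν := ν) hν hε
  refine ⟨max L₀ 2, fun L _ hL hLe => ?_⟩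
  have hL2 : 2 ≤ L := le_trans (le_max_right _ _) hLe
  have h1 := chiralLRO_expect (ν := ν) (L := L) hν1 hL hL2 hN hlog ha0 hw1 hw
  have h2 := (abs_le.1 (hL₀ L hL (le_trans (le_max_left _ _) hLe))).2
  refine le_trans ?_ h1
  -- `(1/4ν)(2/N)(S_Λ - S) ≤ ε`
  have hν1' : (1 : ℝ) ≤ ν := by exact_mod_cast hν1
  have hN1' : (1 : ℝ) ≤ N := by exact_mod_cast hN
  have h3 : 1 / (4 * (ν : ℝ)) * (2 / N) ≤ 1 := by
    rw [div_mul_div_comm, div_le_one (by positivity)]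
    have hprod : (1 : ℝ) ≤ (ν : ℝ) * N := by
      nlinarith [mul_nonneg (sub_nonneg.2 hν1') (sub_nonneg.2 hN1')]
    nlinarith [hprod]
  have h4 : 1 / (4 * (ν : ℝ)) * (2 / N) * (latticeS ν L - fluctS ν) ≤ ε := by
    rcases le_or_gt 0 (latticeS ν L - fluctS ν) with hs | hs
    · calc 1 / (4 * (ν : ℝ)) * (2 / N) * (latticeS ν L - fluctS ν)
          ≤ 1 * (latticeS ν L - fluctS ν) := mul_le_mul_of_nonneg_right h3 hs
        _ ≤ ε := by linarith
    · have : 1 / (4 * (ν : ℝ)) * (2 / N) * (latticeS ν L - fluctS ν) ≤ 0 :=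
        mul_nonpos_of_nonneg_of_nonpos (by positivity) hs.le
      linarith
  have h5 : 1 / (4 * (ν : ℝ)) * (1 / sdK N w - 2 * fluctS ν / N) - ε
      - 1 / (4 * ν) * (1 / sdK N w - 2 * latticeS ν L / N)
      = 1 / (4 * (ν : ℝ)) * (2 / N) * (latticeS ν L - fluctS ν) - ε := by
    field_simp
    ring
  linarith

/-- **Thm. 4.8, conclusion**: under the same hypotheses, if `2S(ν)K(N)/N < 1` ("`ν ≥ ν₀`") there is
`c > 0` with `|Λ|⁻¹∑_x⟨σ_0σ_x⟩_Λ ≥ c` for all large even `L` — chiral long-range order at `m = 0`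
in its uniform finite-volume form. [cite: SalmhoferSeiler1991, Thm. 4.8 with (4.42)] -/
theorem chiralLRO_of_fluctS_lt (hν : 3 ≤ ν) {N : ℕ} (hN : 1 ≤ N)
    {a w : ℕ → ℝ} (hlog : HasLog N a w) (ha0 : a 0 = 1) (hw1 : w 1 = 1)
    (hw : ∀ k, 2 ≤ k → k ≤ N → 0 ≤ w k) (hS : 2 * fluctS ν * sdK N w / N < 1) :
    ∃ c : ℝ, 0 < c ∧ ∃ L₀ : ℕ, ∀ (L : ℕ) [NeZero L], Even L → L₀ ≤ L →
      c ≤ (Fintype.card (TorusSite ν L) : ℝ)⁻¹ *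
          ∑ x : TorusSite ν L, expect N 0 a (MvPolynomial.X (0 : TorusSite ν L) * MvPolynomial.X x) := by
  have hν1 : 1 ≤ ν := by omega
  have hνpos : (0 : ℝ) < ν := by exact_mod_cast hν1
  have hNpos : (0 : ℝ) < N := by exact_mod_cast hN
  have hK : 0 < sdK N w := lt_of_lt_of_le one_pos (one_le_sdK hN hw1 hw)
  set m : ℝ := 1 / (4 * ν) * (1 / sdK N w - 2 * fluctS ν / N) with hm
  have hmpos : 0 < m := by
    have h1 : 2 * fluctS ν / N < 1 / sdK N w := by
      rw [lt_div_iff₀ hK, div_mul_eq_mul_div]; exact hS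
    have : 0 < 1 / sdK N w - 2 * fluctS ν / N := by linarith
    positivity
  obtain ⟨L₀, hL₀⟩ := chiralLRO_expect_limit (ν := ν) hν hN hlog ha0 hw1 hw (ε := m / 2)
    (by positivity)
  refine ⟨m / 2, by positivity, L₀, fun L _ hL hLe => ?_⟩
  have h := hL₀ L hL hLe
  have : m - m / 2 = m / 2 := by ring
  linarith

/-- **Cor. 4.9 with the printed constant, `U(N)`, `N ≤ 4`**: for the `U(N)` lattice gauge theory at
`β = 0` with massless staggered fermions in its complex-spin form, `1 ≤ N ≤ 4`, `ν ≥ 3`: for every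
`ε > 0` and all large even `L`, `|Λ|⁻¹∑_x⟨σ_0σ_x⟩_Λ ≥ (1/4ν)(1/K(N) - 2S(ν)/N) - ε` with the printed
`S(ν)` of (4.3) and `K(1) = 1`, `K(2) = 2`, `K(3) = 10/3`, `K(4) = 83/15` (`sdK_uN_*`).  Positivity
of the bound for `ν ≥ 4` is the computer-assisted Prop. 4.2 (4), not formalised; the analytic
Prop. 4.2 (2) gives it for `ν ≥ 11, 11, 13, 20` (`N = 1, 2, 3, 4`).
[cite: SalmhoferSeiler1991, Cor. 4.9 with Thm. 4.8 (4.42)] -/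
theorem uN_chiralLRO_limit (hν : 3 ≤ ν) {N : ℕ} (hN1 : 1 ≤ N) (hN4 : N ≤ 4) {ε : ℝ} (hε : 0 < ε) :
    ∃ L₀ : ℕ, ∀ (L : ℕ) [NeZero L], Even L → L₀ ≤ L →
      1 / (4 * ν) * (1 / sdK N (uNLogCoeff N) - 2 * fluctS ν / N) - ε ≤
        (Fintype.card (TorusSite ν L) : ℝ)⁻¹ *
          ∑ x : TorusSite ν L, expect N 0 (uNBondCoeff N)
            (MvPolynomial.X (0 : TorusSite ν L) * MvPolynomial.X x) :=
  chiralLRO_expect_limit hν hN1 (hasLog_uN hN1 hN4) (uNBondCoeff_zero N) (uNLogCoeff_one N)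
    (fun k hk2 hkN => uNLogCoeff_nonneg hN4 k hk2 hkN) hε

end ComplexSpin

end Literature.MathematicalPhysics.StatisticalMechanics

end
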